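import Summits.Ventures.PercRepro.Night2ThreeTwoMissedSmall
import Summits.Ventures.PercRepro.Night2ThreeTwoUnsat

/-!
# PercRepro — the `(7, 5)` shadow row modulo the residues X: the `(3, 2)` obstruction cell through the missed-point
hybrid rule (night-2, gen 25)

`shadowHall_seven_five_of_residuesW` leaves, at `(3, 2)`, the cells with a fat non-basis member and a saturated middle
target.  There the hybrid rule with `P :=` the big members (`|B ∖ K| ≥ 4`) and the missed-point shares `dshMissed`
gives (LI_G) from two conditions (`localShadowHall_of_missed`):

* (i) the COLUMN BOUND `dload S ≤ cap2 S` at every shadow set — A TREE THEOREM at every target of every flat of the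
  cell (`dload_missed_le_cap2_three_two`, `Night2ThreeTwoMissedSmall`);
* (ii) the fair-share inequality of the BASIS pairs (`|B ∖ K| = 3`) with the capacities `cap3 = cap2 − dload`.

* **`localShadowHall_three_two_five_of_missed`**: the cell `(3, 2)` from (i) and (ii);
* **`localShadowHall_three_two_five_of_basisFair`**: the cell `(3, 2)` from (ii) alone;
* **`shadowHall_seven_five_of_residuesX`**: `ShadowHall M 7 5 (phiK 7 5)` for every finite matroid modulo `(2, 0)`,
  `(2, 1)` as in the residues V and, at `(3, 2)`, the obstruction cells in which (ii) fails at some basis pair.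
-/

namespace PercRepro.Shadow

open Finset PerFlat ThmH

variable {α : Type*} [DecidableEq α] {M : Matroid α} [M.Finite]

section ThreeTwoMissed

variable {G : Finset α}

/-- The big members: `|B ∖ K| ≥ 4`. -/
abbrev BigMember (M : Matroid α) [M.Finite] (G : Finset α) (B : Finset α) : Prop := 4 ≤ (B \ coloops M G).card

open scoped Classical in
/-- **The cell `(3, 2)` through the missed-point hybrid rule**: (LI_G) from the column bound (i) and the basis pairs'
fair-share inequality (ii). -/
theorem localShadowHall_three_two_five_of_missed (hG : G ∈ flatsQ M (5 + 1)) (hd : (gr M \ G).card = 3)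
    (hdl : ∀ S ∈ shadowAt M (5 + 2) 5 (Uq M (5 + 2) 5) G,
      dload M 5 G (BigMember M G) (dshMissed M 5 G) S ≤ cap2 M 5 G S)
    (hcond : ∀ B ∈ thinMembers M 5 G, ¬ BigMember M G B → ∀ z ∈ G \ clF M B,
      loss M 5 G B z ≤ rhoL M 5 G B z * lossIncomeH M 5 G (BigMember M G) (dshMissed M 5 G) B z) :
    LocalShadowHall M 5 G :=
  localShadowHall_of_missed hG (by omega) hdl hcond

open scoped Classical in
/-- **The cell `(3, 2)` from the basis pairs' inequality alone**: the column bound holds at every target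
(`dload_missed_le_cap2_three_two`). -/
theorem localShadowHall_three_two_five_of_basisFair (hG : G ∈ flatsQ M (5 + 1)) (hd : (gr M \ G).card = 3)
    (hk : kColoops M G = 2) (hs : ∀ e ∈ gr M, ∀ f ∈ gr M, e ≠ f → rkN M {e, f} = 2)
    (hl : ∀ e ∈ gr M, M.Indep {e})
    (hcond : ∀ B ∈ thinMembers M 5 G, ¬ BigMember M G B → ∀ z ∈ G \ clF M B,
      loss M 5 G B z ≤ rhoL M 5 G B z * lossIncomeH M 5 G (BigMember M G) (dshMissed M 5 G) B z) :
    LocalShadowHall M 5 G :=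
  localShadowHall_three_two_five_of_missed hG hd
    (fun S _ => dload_missed_le_cap2_three_two hG hd hk hs hl (fun _ h => h) S) hcond

end ThreeTwoMissed

section SevenFiveX

variable {α' : Type} [DecidableEq α']

open scoped Classical in
/-- **THE `(7, 5)` SHADOW ROW FOR EVERY FINITE MATROID MODULO THE RESIDUES X**: `(2, 0)`, `(2, 1)` as in the residues V
and, at `(3, 2)`, the obstruction cells (a fat non-basis member and a saturated middle target) in which the basis pairs'
fair-share inequality with `cap3` fails at some basis pair — the column bound of the missed-point routing of the big
pairs holds at every target (`dload_missed_le_cap2_three_two`). -/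
theorem shadowHall_seven_five_of_residuesX
    (h20 : ∀ (N : Matroid α') [N.Finite] (G : Finset α'), CellHyp N G →
      (gr N \ G).card = 2 → kColoops N G = 0 → FatMember N G 6 3 →
      (FatBasis N G 6 2 ∨ FatMember N G 6 2) →
      (2 ≤ (fatClosures N 5 G 2).card ∨
        ∃ B ∈ thinMembers N 5 G, 2 < (G \ clF N B).card ∧ (G \ clF N B).card < 5) →
      LocalShadowHall N 5 G)
    (h21 : ∀ (N : Matroid α') [N.Finite] (G : Finset α'), CellHyp N G →
      (gr N \ G).card = 2 → kColoops N G = 1 → FatMember N G 5 4 →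
      (FatBasis N G 5 3 ∨ FatMember N G 5 3) →
      (2 ≤ (fatClosures N 5 G 2).card ∨
        ∃ B ∈ thinMembers N 5 G, 2 < (G \ clF N B).card ∧ (G \ clF N B).card < 7) →
      LocalShadowHall N 5 G)
    (h32 : ∀ (N : Matroid α') [N.Finite] (G : Finset α'), CellHyp N G →
      (gr N \ G).card = 3 → kColoops N G = 2 → FatMember N G 4 2 →
      (∃ S ∈ shadowAt N (5 + 2) 5 (Uq N (5 + 2) 5) G, 4 + 1 ≤ (S \ coloops N G).card ∧
        capS N 5 G S < L1 N 5 G S) →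
      (∃ B ∈ thinMembers N 5 G, ¬ BigMember N G B ∧ ∃ z ∈ G \ clF N B,
        rhoL N 5 G B z * lossIncomeH N 5 G (BigMember N G) (dshMissed N 5 G) B z < loss N 5 G B z) →
      LocalShadowHall N 5 G)
    (M : Matroid α') [M.Finite] : ShadowHall M 7 5 (phiK 7 5) := by
  apply shadowHall_seven_five_of_residuesW h20 h21
  intro N _ G hcell hd hk hfm hsat
  have hG := hcell.2.2.2
  have hs := hcell.1
  have hl := hcell.2.1
  by_cases hcond : ∀ B ∈ thinMembers N 5 G, ¬ BigMember N G B → ∀ z ∈ G \ clF N B,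
      loss N 5 G B z ≤ rhoL N 5 G B z * lossIncomeH N 5 G (BigMember N G) (dshMissed N 5 G) B z
  · exact localShadowHall_three_two_five_of_basisFair hG hd hk hs hl hcond
  · push Not at hcond
    obtain ⟨B, hB, hnb, z, hz, hlt⟩ := hcond
    exact h32 N G hcell hd hk hfm hsat ⟨B, hB, fun h => absurd h (by unfold BigMember; omega), z, hz, hlt⟩

end SevenFiveX

end PercRepro.Shadow
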